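import Literature.Topology.FourManifolds.CreaseSmoothing
import Literature.Topology.FourManifolds.StageInChart
import Mathlib.Topology.MetricSpace.Thickening
import HarnessLib

/-!
# The codimension-one stage of the sweep: a crease in a chart pair, smoothed and conjugated back

Topic `Literature/Topology/FourManifolds`; the codimension-one ("face") stage of the downward sweep
of the smoothing of PD homeomorphisms (Munkres, Ann. of Math. 72 (1960), §§2–3; Campbell–D'Onofrio–
Vítek, J. Geom. Anal. (2026), Lemma 3.1), assembling `CreaseSmoothing.lean` (the analysis in the
one-sided normal form) with `StageInChart.lean` (conjugation by a chart pair with a hard switch).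

**Setting.** `u : H → H'` is the current map between the source and target chart spaces; the
codimension-one simplex is presented by a chart pair `Θ : E × ℝ → H`, `Θ' : E × ℝ → H'` (open
partial homeomorphisms, smooth with smooth inverses — in the sweep `Θ = f₊ ∘ A`, `Θ' = h₊ ∘ A` for
the smooth models `f₊`, `h₊` of the two PD charts on the upper top simplex and an affine
isomorphism `A` onto the PL picture) over a box `V × (-δ, δ)`, `V ⊇ K` open, `K` compact, such
that in these coordinates the map is the identity on the closed upper half (`u (Θ p) = Θ' p` for
`0 ≤ p.2`) and a smooth map `Glow` on the closed lower half (`u (Θ p) = Θ' (Glow p)` for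
`p.2 ≤ 0`; in the sweep `Glow = Θ'⁻¹ ∘ G₋ ∘ Θ` with `G₋` the lower sector model), `Glow` a local
diffeomorphism there, and `p ↦ u (Θ p)` injective on the box.

* `creaseNormal_pos_of_injOn` — then `Glow` fixes the face pointwise and crosses it positively,
  `(D Glow (x,0) (0,1)).2 > 0`: a negative normal component would push lower points into the upper
  half where the map is the identity, contradicting injectivity, and a vanishing one contradicts
  invertibility of `D Glow (x, 0)` (which is the identity on face directions).  This is the
  orientation bookkeeping of the reduction to normal form, done once and for all from injectivity.
* `exists_equiv_of_face_normal_bounds` — an operator of `E × ℝ` which is `ε`-close to the identity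
  on `E × 0` and whose normal column `(c, a)` has `a ≥ a₀ > 0`, `‖c‖ ≤ C₀`, is invertible when
  `ε (a₀ + C₀) < a₀`.
* `exists_creaseStage` — **the stage**: constants `a₀ > 0`, `A₀`, `C₀` and an open `V₀`,
  `K ⊆ V₀ ⊆ V`, such that for every `ε > 0` there are a layer width `0 < W ≤ ε` and a `C^∞` map
  `g` (the smoothed crease `creaseMap Glow L w`) for which the conjugated stage
  `u' = conjStage Θ Θ' g S u` on the region `S = creaseRegion Θ V₀ δ` (the `Θ`-image of the box
  `V₀ × (-δ/2, δ/2)`) satisfies: `u' = u` off `S` and at the points of `S` outside the thin band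
  `0 < s < W`; `u'` is `C^∞` with invertible derivative at every point of `S`; and on the band the
  RECORD `u' z = Θ' (g q)`, `q = Θ.symm z`, with `‖g q - q‖ ≤ ε`, `‖Dg q (v,0) - (v,0)‖ ≤ ε ‖v‖`,
  `a₀ ≤ (Dg q (0,1)).2 ≤ A₀`, `‖(Dg q (0,1)).1‖ ≤ C₀` — the form read by the faces of the simplex.
  Lateral garbage (the hard switch across `Θ (∂V₀ × [0, W])`) is the consumer's to swallow.

`creaseRegion` is the only definition (an explicit set); no named facts.

## References

* J. R. Munkres, *Obstructions to the smoothing of piecewise-differentiable homeomorphisms*, Ann.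
  of Math. (2) 72 (1960), 521–554, §§2–3. [Munkres1960]
* D. Campbell, L. D'Onofrio, T. Vítek, *Diffeomorphic approximation of piecewise affine
  homeomorphisms*, J. Geom. Anal. 36 (2026), Lemma 3.1. [CampbellDonofrioVitek2026]
-/

noncomputable section

open Set Function Metric Filter Real
open scoped Topology ContDiff

namespace Literature.Topology.FourManifolds

/-! ### Linear algebra: operators close to upper triangular with positive corner are invertible -/

section LinAlg

variable {E : Type*} [NormedAddCommGroup E] [NormedSpace ℝ E] [FiniteDimensional ℝ E]

/-- **Invertibility from the face/normal bounds.** Let `T` be a continuous linear self-map of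
`E × ℝ` with `‖T (v, 0) - (v, 0)‖ ≤ ε ‖v‖`, `(T (0,1)).2 ≥ a₀ > 0`, `‖(T (0,1)).1‖ ≤ C₀`, and
`ε (a₀ + C₀) < a₀`.  Then `T` is invertible. [folklore] -/
theorem exists_equiv_of_face_normal_bounds {T : E × ℝ →L[ℝ] E × ℝ} {ε a₀ C₀ : ℝ} (ha₀ : 0 < a₀)
    (hε : ∀ v : E, ‖T (v, 0) - (v, 0)‖ ≤ ε * ‖v‖) (ha : a₀ ≤ (T (0, 1)).2)
    (hc : ‖(T (0, 1)).1‖ ≤ C₀) (hsmall : ε * (a₀ + C₀) < a₀) :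
    ∃ L : (E × ℝ) ≃L[ℝ] E × ℝ, (L : E × ℝ →L[ℝ] E × ℝ) = T := by
  have hC₀ : 0 ≤ C₀ := (norm_nonneg _).trans hc
  have hapos : 0 < (T (0, 1)).2 := ha₀.trans_le ha
  have hinj : Injective T := by
    refine (injective_iff_map_eq_zero _).2 fun p hp => ?_
    obtain ⟨v, t⟩ := p
    have hdec : T (v, t) = T (v, 0) + t • T (0, 1) := by
      have : ((v, t) : E × ℝ) = (v, 0) + t • ((0 : E), (1 : ℝ)) := by ext <;> simp
      rw [this, map_add, map_smul]
    rw [hdec] at hp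
    have h1 : (T (v, 0)).1 + t • (T (0, 1)).1 = 0 := by
      have := congrArg Prod.fst hp; simpa using this
    have h2 : (T (v, 0)).2 + t * (T (0, 1)).2 = 0 := by
      have := congrArg Prod.snd hp; simpa using this
    have hv := hε v
    have hv1 : ‖(T (v, 0)).1 - v‖ ≤ ε * ‖v‖ := by
      have := norm_fst_le ((T (v, 0)) - (v, 0))
      simp only [Prod.fst_sub] at this
      exact this.trans hv
    have hv2 : |(T (v, 0)).2| ≤ ε * ‖v‖ := by
      have := norm_snd_le ((T (v, 0)) - (v, 0))
      simp only [Prod.snd_sub, sub_zero, Real.norm_eq_abs] at this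
      exact this.trans hv
    -- `|t| a₀ ≤ ε ‖v‖`
    have ht : |t| * a₀ ≤ ε * ‖v‖ := by
      have e : t * (T (0, 1)).2 = -(T (v, 0)).2 := by linarith
      calc |t| * a₀ ≤ |t| * (T (0, 1)).2 := by gcongr
        _ = |t * (T (0, 1)).2| := by rw [abs_mul, abs_of_pos hapos]
        _ = |(T (v, 0)).2| := by rw [e, abs_neg]
        _ ≤ ε * ‖v‖ := hv2
    -- `‖v‖ ≤ ε ‖v‖ + |t| C₀`
    have hvt : ‖v‖ ≤ ε * ‖v‖ + |t| * C₀ := by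
      have e : v = (v - (T (v, 0)).1) - t • (T (0, 1)).1 := by
        have h1' : (T (v, 0)).1 = -(t • (T (0, 1)).1) := eq_neg_of_add_eq_zero_left h1
        rw [h1']; abel
      calc ‖v‖ = ‖(v - (T (v, 0)).1) - t • (T (0, 1)).1‖ := by rw [← e]
        _ ≤ ‖v - (T (v, 0)).1‖ + ‖t • (T (0, 1)).1‖ := norm_sub_le _ _
        _ ≤ ε * ‖v‖ + |t| * C₀ := by
            rw [norm_sub_rev, norm_smul, Real.norm_eq_abs]
            gcongr
    -- combine
    have hv0 : ‖v‖ = 0 := by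
      by_contra hne
      have hpos : 0 < ‖v‖ := lt_of_le_of_ne (norm_nonneg _) (Ne.symm hne)
      have key : ‖v‖ * a₀ ≤ ε * ‖v‖ * a₀ + ε * ‖v‖ * C₀ := by
        have h3 : ‖v‖ * a₀ ≤ (ε * ‖v‖ + |t| * C₀) * a₀ := mul_le_mul_of_nonneg_right hvt ha₀.le
        have h4 : |t| * C₀ * a₀ ≤ ε * ‖v‖ * C₀ := by
          calc |t| * C₀ * a₀ = |t| * a₀ * C₀ := by ring
            _ ≤ ε * ‖v‖ * C₀ := mul_le_mul_of_nonneg_right ht hC₀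
        nlinarith
      have : ‖v‖ * (a₀ - ε * (a₀ + C₀)) ≤ 0 := by nlinarith
      have hfac : 0 < a₀ - ε * (a₀ + C₀) := by linarith
      nlinarith
    have hv' : v = 0 := norm_eq_zero.1 hv0
    subst hv'
    have ht0 : t = 0 := by
      rw [norm_zero, mul_zero] at ht
      have habs : |t| ≤ 0 := by
        by_contra h
        have : 0 < |t| := lt_of_not_ge h
        nlinarith
      exact abs_eq_zero.1 (le_antisymm habs (abs_nonneg t))
    subst ht0
    rfl
  exact ⟨LinearEquiv.toContinuousLinearEquiv (LinearEquiv.ofInjectiveEndo T.toLinearMap hinj),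
    by ext v <;> rfl⟩

omit [FiniteDimensional ℝ E] in
/-- **Quantitative lower bound from the face/normal bounds.** With `T` as in
`exists_equiv_of_face_normal_bounds` (`‖T (v,0) - (v,0)‖ ≤ ε ‖v‖`, `(T (0,1)).2 ≥ a₀ > 0`,
`‖(T (0,1)).1‖ ≤ C₀`, `ε ≥ 0`) and `κ = 1 + (C₀ + 1)/a₀`: `(1 - ε κ) ‖z‖ ≤ κ ‖T z‖` for all
`z` (sup norm on `E × ℝ`). [folklore] -/
theorem norm_le_of_face_normal_bounds {T : E × ℝ →L[ℝ] E × ℝ} {ε a₀ C₀ : ℝ} (ha₀ : 0 < a₀)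
    (hε0 : 0 ≤ ε) (hε : ∀ v : E, ‖T (v, 0) - (v, 0)‖ ≤ ε * ‖v‖) (ha : a₀ ≤ (T (0, 1)).2)
    (hc : ‖(T (0, 1)).1‖ ≤ C₀) (z : E × ℝ) :
    (1 - ε * (1 + (C₀ + 1) / a₀)) * ‖z‖ ≤ (1 + (C₀ + 1) / a₀) * ‖T z‖ := by
  obtain ⟨v, t⟩ := z
  have hC₀ : 0 ≤ C₀ := (norm_nonneg _).trans hc
  have hapos : 0 < (T (0, 1)).2 := ha₀.trans_le ha
  have hdec : T (v, t) = T (v, 0) + t • T (0, 1) := by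
    have : ((v, t) : E × ℝ) = (v, 0) + t • ((0 : E), (1 : ℝ)) := by ext <;> simp
    rw [this, map_add, map_smul]
  -- abbreviations (plain reals)
  have hZdef : ‖((v, t) : E × ℝ)‖ = max ‖v‖ |t| := by
    rw [Prod.norm_def, Real.norm_eq_abs]
  have hvz : ‖v‖ ≤ ‖((v, t) : E × ℝ)‖ := by rw [hZdef]; exact le_max_left _ _
  have htz : |t| ≤ ‖((v, t) : E × ℝ)‖ := by rw [hZdef]; exact le_max_right _ _
  -- bounds for the face part of `T (v, 0)`
  have hv1 : ‖(T (v, 0)).1 - v‖ ≤ ε * ‖v‖ := by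
    have := norm_fst_le ((T (v, 0)) - (v, 0))
    simp only [Prod.fst_sub] at this
    exact this.trans (hε v)
  have hv2 : |(T (v, 0)).2| ≤ ε * ‖v‖ := by
    have := norm_snd_le ((T (v, 0)) - (v, 0))
    simp only [Prod.snd_sub, sub_zero, Real.norm_eq_abs] at this
    exact this.trans (hε v)
  -- components of `T (v, t)`
  have hw2 : (T (v, t)).2 = (T (v, 0)).2 + t * (T (0, 1)).2 := by rw [hdec]; simp
  have hw1 : (T (v, t)).1 = (T (v, 0)).1 + t • (T (0, 1)).1 := by rw [hdec]; simp
  have hw2n : |(T (v, t)).2| ≤ ‖T (v, t)‖ := by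
    simpa [Real.norm_eq_abs] using norm_snd_le (T (v, t))
  have hw1n : ‖(T (v, t)).1‖ ≤ ‖T (v, t)‖ := norm_fst_le (T (v, t))
  -- `|t| a₀ ≤ ‖T z‖ + ε ‖v‖`
  have ht : |t| * a₀ ≤ ‖T (v, t)‖ + ε * ‖v‖ := by
    have e : t * (T (0, 1)).2 = (T (v, t)).2 - (T (v, 0)).2 := by linarith
    calc |t| * a₀ ≤ |t| * (T (0, 1)).2 := by gcongr
      _ = |(T (v, t)).2 - (T (v, 0)).2| := by rw [← abs_of_pos hapos, ← abs_mul, e]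
      _ ≤ |(T (v, t)).2| + |(T (v, 0)).2| := abs_sub _ _
      _ ≤ ‖T (v, t)‖ + ε * ‖v‖ := add_le_add hw2n hv2
  -- `‖v‖ ≤ ‖T z‖ + |t| C₀ + ε ‖v‖`
  have hvb : ‖v‖ ≤ ‖T (v, t)‖ + |t| * C₀ + ε * ‖v‖ := by
    have e : v = (T (v, t)).1 - t • (T (0, 1)).1 - ((T (v, 0)).1 - v) := by rw [hw1]; abel
    calc ‖v‖ = ‖(T (v, t)).1 - t • (T (0, 1)).1 - ((T (v, 0)).1 - v)‖ := by rw [← e]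
      _ ≤ ‖(T (v, t)).1‖ + ‖t • (T (0, 1)).1‖ + ‖(T (v, 0)).1 - v‖ :=
          norm_sub_le_of_le (norm_sub_le _ _) le_rfl
      _ ≤ ‖T (v, t)‖ + |t| * C₀ + ε * ‖v‖ := by
          rw [norm_smul, Real.norm_eq_abs]
          gcongr
  -- combine
  set Z := ‖((v, t) : E × ℝ)‖ with hZ
  set W := ‖T (v, t)‖ with hW
  have hZ0 : 0 ≤ Z := norm_nonneg _
  have hW0 : 0 ≤ W := norm_nonneg _
  have hεv : ε * ‖v‖ ≤ ε * Z := mul_le_mul_of_nonneg_left hvz hε0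
  have ht' : |t| * a₀ ≤ W + ε * Z := by linarith
  have ht'' : |t| ≤ (W + ε * Z) / a₀ := by rw [le_div_iff₀ ha₀]; exact ht'
  have hv' : ‖v‖ ≤ W + (W + ε * Z) / a₀ * C₀ + ε * Z := by
    have h1 : |t| * C₀ ≤ (W + ε * Z) / a₀ * C₀ := mul_le_mul_of_nonneg_right ht'' hC₀
    linarith
  -- both components are `≤ κ W + ε κ Z`, `κ = 1 + (C₀ + 1)/a₀`
  have hk1 : 1 + C₀ / a₀ ≤ 1 + (C₀ + 1) / a₀ := by
    have : C₀ / a₀ ≤ (C₀ + 1) / a₀ := by gcongr; linarith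
    linarith
  have hk2 : 1 / a₀ ≤ 1 + (C₀ + 1) / a₀ := by
    have : 1 / a₀ ≤ (C₀ + 1) / a₀ := by gcongr; linarith
    have : 0 ≤ (1 : ℝ) := zero_le_one
    linarith
  have hv'' : ‖v‖ ≤ (1 + (C₀ + 1) / a₀) * W + ε * (1 + (C₀ + 1) / a₀) * Z := by
    have e : W + (W + ε * Z) / a₀ * C₀ + ε * Z = (1 + C₀ / a₀) * W + ε * (1 + C₀ / a₀) * Z := by
      field_simp; ring
    rw [e] at hv'
    have h1 : (1 + C₀ / a₀) * W ≤ (1 + (C₀ + 1) / a₀) * W := mul_le_mul_of_nonneg_right hk1 hW0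
    have h2 : ε * (1 + C₀ / a₀) * Z ≤ ε * (1 + (C₀ + 1) / a₀) * Z :=
      mul_le_mul_of_nonneg_right (mul_le_mul_of_nonneg_left hk1 hε0) hZ0
    linarith
  have ht3 : |t| ≤ (1 + (C₀ + 1) / a₀) * W + ε * (1 + (C₀ + 1) / a₀) * Z := by
    have e : (W + ε * Z) / a₀ = (1 / a₀) * W + ε * (1 / a₀) * Z := by ring
    rw [e] at ht''
    have h1 : (1 / a₀) * W ≤ (1 + (C₀ + 1) / a₀) * W := mul_le_mul_of_nonneg_right hk2 hW0
    have h2 : ε * (1 / a₀) * Z ≤ ε * (1 + (C₀ + 1) / a₀) * Z :=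
      mul_le_mul_of_nonneg_right (mul_le_mul_of_nonneg_left hk2 hε0) hZ0
    linarith
  have hZle : max ‖v‖ |t| ≤ (1 + (C₀ + 1) / a₀) * W + ε * (1 + (C₀ + 1) / a₀) * Z :=
    max_le hv'' ht3
  rw [← hZdef] at hZle
  show (1 - ε * (1 + (C₀ + 1) / a₀)) * Z ≤ (1 + (C₀ + 1) / a₀) * W
  linarith

end LinAlg

/-! ### The one-sided normal form of a crease in a chart pair -/

section NormalForm

variable {E : Type*} [NormedAddCommGroup E] [NormedSpace ℝ E] [FiniteDimensional ℝ E]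
variable {H : Type*} [NormedAddCommGroup H] [NormedSpace ℝ H]
variable {H' : Type*} [NormedAddCommGroup H'] [NormedSpace ℝ H']

/-- The open box `V × (-δ, δ)` of the normal coordinates. [folklore] -/
def creaseBox (V : Set E) (δ : ℝ) : Set (E × ℝ) := {p | p.1 ∈ V ∧ |p.2| < δ}

omit [NormedAddCommGroup E] [NormedSpace ℝ E] [FiniteDimensional ℝ E] in
/-- Membership in the box. [folklore] -/
theorem mem_creaseBox_iff {V : Set E} {δ : ℝ} {p : E × ℝ} :
    p ∈ creaseBox V δ ↔ p.1 ∈ V ∧ |p.2| < δ := Iff.rfl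

omit [NormedSpace ℝ E] [FiniteDimensional ℝ E] in
/-- The box is open for `V` open. [folklore] -/
theorem isOpen_creaseBox {V : Set E} (hV : IsOpen V) (δ : ℝ) : IsOpen (creaseBox V δ) :=
  (hV.preimage continuous_fst).inter
    (isOpen_lt (continuous_abs.comp continuous_snd) continuous_const)

/-- **The crease region** in the source chart space: the points of `Θ.target` whose normal
coordinates lie in the box `V × (-δ, δ)`. [folklore] -/
def creaseRegion (Θ : OpenPartialHomeomorph (E × ℝ) H) (V : Set E) (δ : ℝ) : Set H :=
  Θ.target ∩ Θ.symm ⁻¹' creaseBox V δ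

omit [NormedSpace ℝ E] [FiniteDimensional ℝ E] [NormedSpace ℝ H] in
/-- Membership in the crease region. [folklore] -/
theorem mem_creaseRegion_iff {Θ : OpenPartialHomeomorph (E × ℝ) H} {V : Set E} {δ : ℝ} {z : H} :
    z ∈ creaseRegion Θ V δ ↔ z ∈ Θ.target ∧ (Θ.symm z).1 ∈ V ∧ |(Θ.symm z).2| < δ := Iff.rfl

omit [NormedSpace ℝ E] [FiniteDimensional ℝ E] [NormedSpace ℝ H] in
/-- The crease region is open. [folklore] -/
theorem isOpen_creaseRegion (Θ : OpenPartialHomeomorph (E × ℝ) H) {V : Set E} (hV : IsOpen V)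
    (δ : ℝ) : IsOpen (creaseRegion Θ V δ) :=
  Θ.isOpen_inter_preimage_symm (isOpen_creaseBox hV δ)

omit [NormedSpace ℝ E] [FiniteDimensional ℝ E] [NormedSpace ℝ H] in
/-- The crease region lies in the chart target. [folklore] -/
theorem creaseRegion_subset_target (Θ : OpenPartialHomeomorph (E × ℝ) H) (V : Set E) (δ : ℝ) :
    creaseRegion Θ V δ ⊆ Θ.target := inter_subset_left

/-- **One-sided normal form of a crease.** In the chart pair `(Θ, Θ')` over the box `V × (-δ, δ)`
the current map `u` reads as the identity on the closed upper half and as the smooth local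
diffeomorphism `Glow` on the closed lower half, and `p ↦ u (Θ p)` is injective on the box.
(Bookkeeping predicate; in the sweep `Θ = f₊ ∘ A`, `Θ' = h₊ ∘ A`, `Glow = Θ'⁻¹ ∘ G₋ ∘ Θ`.)
[folklore] -/
structure IsCreaseNormalForm (Θ : OpenPartialHomeomorph (E × ℝ) H)
    (Θ' : OpenPartialHomeomorph (E × ℝ) H') (u : H → H') (Glow : E × ℝ → E × ℝ) (V : Set E)
    (δ : ℝ) : Prop where
  isOpen : IsOpen V
  pos : 0 < δ
  source : ∀ p : E × ℝ, p.1 ∈ V → |p.2| < δ → p ∈ Θ.source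
  source' : ∀ p : E × ℝ, p.1 ∈ V → |p.2| < δ → p ∈ Θ'.source
  up : ∀ p : E × ℝ, p.1 ∈ V → 0 ≤ p.2 → p.2 < δ → u (Θ p) = Θ' p
  low_mem : ∀ p : E × ℝ, p.1 ∈ V → -δ < p.2 → p.2 ≤ 0 → Glow p ∈ Θ'.source
  low : ∀ p : E × ℝ, p.1 ∈ V → -δ < p.2 → p.2 ≤ 0 → u (Θ p) = Θ' (Glow p)
  injOn : InjOn (fun p => u (Θ p)) (creaseBox V δ)
  glow_contDiff : ContDiff ℝ ∞ Glow
  glow_deriv : ∀ p : E × ℝ, p.1 ∈ V → -δ < p.2 → p.2 ≤ 0 →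
    ∃ L : (E × ℝ) ≃L[ℝ] E × ℝ, HasFDerivAt Glow (L : E × ℝ →L[ℝ] E × ℝ) p

variable {Θ : OpenPartialHomeomorph (E × ℝ) H} {Θ' : OpenPartialHomeomorph (E × ℝ) H'}
  {u : H → H'} {Glow : E × ℝ → E × ℝ} {V : Set E} {δ : ℝ}

omit [FiniteDimensional ℝ E] [NormedSpace ℝ H] [NormedSpace ℝ H'] in
/-- **The lower model fixes the face pointwise.** [folklore] -/
theorem IsCreaseNormalForm.face_fixed (h : IsCreaseNormalForm Θ Θ' u Glow V δ) {x : E}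
    (hx : x ∈ V) : Glow (x, 0) = (x, 0) := by
  have h1 := h.up (x, 0) hx le_rfl h.pos
  have h2 := h.low (x, 0) hx (by simpa using h.pos) le_rfl
  have hmem := h.low_mem (x, 0) hx (by simpa using h.pos) le_rfl
  exact Θ'.injOn hmem (h.source' (x, 0) hx (by simpa using h.pos)) (h2.symm.trans h1)

omit [FiniteDimensional ℝ E] [NormedSpace ℝ H] [NormedSpace ℝ H'] in
/-- The derivative of the lower model at a face point is the identity on face directions.
[folklore] -/
theorem IsCreaseNormalForm.deriv_face (h : IsCreaseNormalForm Θ Θ' u Glow V δ) {x : E}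
    (hx : x ∈ V) {L : (E × ℝ) ≃L[ℝ] E × ℝ} (hL : HasFDerivAt Glow (L : E × ℝ →L[ℝ] E × ℝ) (x, 0))
    (v : E) : L (v, 0) = (v, 0) := by
  have hpath : HasDerivAt (fun s : ℝ => ((x + s • v, (0 : ℝ)) : E × ℝ)) ((v, 0) : E × ℝ) 0 := by
    refine HasDerivAt.prodMk ?_ (hasDerivAt_const _ _)
    simpa using ((hasDerivAt_id (0 : ℝ)).smul_const v).const_add x
  have hL0 : HasFDerivAt Glow (L : E × ℝ →L[ℝ] E × ℝ)
      ((fun s : ℝ => ((x + s • v, (0 : ℝ)) : E × ℝ)) 0) := by simpa using hL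
  have hcomp : HasDerivAt (fun s : ℝ => Glow (x + s • v, 0)) (L (v, 0)) 0 :=
    hL0.comp_hasDerivAt (f := fun s : ℝ => ((x + s • v, (0 : ℝ)) : E × ℝ)) (0 : ℝ) hpath
  have hev : (fun s : ℝ => Glow (x + s • v, 0)) =ᶠ[𝓝 0]
      fun s => ((x + s • v, (0 : ℝ)) : E × ℝ) := by
    have hc : Continuous fun s : ℝ => x + s • v := by fun_prop
    have : ∀ᶠ s : ℝ in 𝓝 0, x + s • v ∈ V :=
      hc.continuousAt.preimage_mem_nhds (by simpa using h.isOpen.mem_nhds hx)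
    filter_upwards [this] with s hs
    exact h.face_fixed hs
  exact hcomp.unique (hpath.congr_of_eventuallyEq hev)

omit [FiniteDimensional ℝ E] [NormedSpace ℝ H] [NormedSpace ℝ H'] in
/-- **The lower model crosses the face positively**: `(D Glow (x,0) (0,1)).2 > 0` for `x ∈ V`.
A negative normal component would send lower points `(x, -t)` into the upper half, where `u ∘ Θ`
is `Θ'` itself, contradicting injectivity of `u ∘ Θ` on the box; a vanishing one would make
`D Glow (x,0)` (the identity on face directions) non-surjective. [folklore] -/
theorem IsCreaseNormalForm.creaseNormal_pos (h : IsCreaseNormalForm Θ Θ' u Glow V δ) {x : E}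
    (hx : x ∈ V) : 0 < (creaseNormal Glow x).2 := by
  obtain ⟨L, hL⟩ := h.glow_deriv (x, 0) hx (by simpa using h.pos) le_rfl
  have hcn : creaseNormal Glow x = L (0, 1) := by
    rw [creaseNormal, hL.fderiv]; rfl
  have hLface := h.deriv_face hx hL
  rw [hcn]
  by_contra hle
  rw [not_lt] at hle
  rcases hle.lt_or_eq with hlt | heq
  · -- `a < 0`
    have hpath : HasDerivAt (fun t : ℝ => ((x, -t) : E × ℝ)) ((0, -1) : E × ℝ) 0 :=
      (hasDerivAt_const _ _).prodMk (hasDerivAt_neg (0 : ℝ))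
    have hL0 : HasFDerivAt Glow (L : E × ℝ →L[ℝ] E × ℝ)
        ((fun t : ℝ => ((x, -t) : E × ℝ)) 0) := by simpa using hL
    have hcomp : HasDerivAt (fun t : ℝ => Glow (x, -t)) (L (0, -1)) 0 :=
      hL0.comp_hasDerivAt (f := fun t : ℝ => ((x, -t) : E × ℝ)) (0 : ℝ) hpath
    have hsnd : HasDerivAt (fun t : ℝ => (Glow (x, -t)).2) (-(L (0, 1)).2) 0 := by
      have h1 := (ContinuousLinearMap.snd ℝ E ℝ).hasFDerivAt.comp_hasDerivAt (0 : ℝ) hcomp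
      have hval : (ContinuousLinearMap.snd ℝ E ℝ) (L (0, -1)) = -(L (0, 1)).2 := by
        have : ((0 : E), (-1 : ℝ)) = -((0 : E), (1 : ℝ)) := by ext <;> simp
        rw [this, map_neg]; rfl
      rw [hval] at h1
      exact h1
    have h0 : (Glow (x, -0)).2 = 0 := by rw [neg_zero, h.face_fixed hx]
    -- eventually `(Glow (x,-t)).2 > 0` for `t > 0`
    have hev1 : ∀ᶠ t in 𝓝[>] (0 : ℝ), 0 < (Glow (x, -t)).2 := by
      have hs := hsnd.tendsto_slope_zero_right
      have hpos' : 0 < -(L (0, 1)).2 := by linarith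
      have h2 := hs.eventually (lt_mem_nhds hpos')
      filter_upwards [h2, self_mem_nhdsWithin] with t ht ht0
      rw [zero_add, h0, sub_zero, smul_eq_mul] at ht
      have ht0' : (0 : ℝ) < t := ht0
      by_contra hneg
      rw [not_lt] at hneg
      have : t⁻¹ * (Glow (x, -t)).2 ≤ 0 :=
        mul_nonpos_of_nonneg_of_nonpos (inv_nonneg.2 ht0'.le) hneg
      linarith
    -- eventually `Glow (x, -t)` and `(x, -t)` lie in the box
    have hev2 : ∀ᶠ t in 𝓝 (0 : ℝ), Glow (x, -t) ∈ creaseBox V δ ∧ |t| < δ := by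
      have hc : ContinuousAt (fun t : ℝ => Glow (x, -t)) 0 := hcomp.continuousAt
      have hval : Glow (x, -(0 : ℝ)) ∈ creaseBox V δ := by
        rw [neg_zero, h.face_fixed hx]; exact ⟨hx, by simpa using h.pos⟩
      have hA : ∀ᶠ t in 𝓝 (0 : ℝ), Glow (x, -t) ∈ creaseBox V δ :=
        hc.preimage_mem_nhds ((isOpen_creaseBox h.isOpen δ).mem_nhds hval)
      have hB : ∀ᶠ t in 𝓝 (0 : ℝ), |t| < δ := by
        have : Iio δ ∈ 𝓝 (|(0 : ℝ)|) := by simpa using Iio_mem_nhds h.pos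
        exact continuous_abs.continuousAt.preimage_mem_nhds this
      exact hA.and hB
    obtain ⟨t, ⟨hpos2, hbox, htδ⟩, ht0⟩ :=
      ((hev1.and (hev2.filter_mono nhdsWithin_le_nhds)).and self_mem_nhdsWithin).exists
    have ht0' : (0 : ℝ) < t := ht0
    set p : E × ℝ := Glow (x, -t) with hp
    have hup := h.up p hbox.1 hpos2.le ((abs_lt.1 hbox.2).2)
    have hlow := h.low (x, -t) hx (by rw [abs_lt] at htδ; linarith) (by linarith)
    have hmem : ((x, -t) : E × ℝ) ∈ creaseBox V δ := ⟨hx, by simpa [abs_neg] using htδ⟩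
    have heq : ((x, -t) : E × ℝ) = p := h.injOn hmem hbox (hlow.trans hup.symm)
    have : (-t : ℝ) = p.2 := congrArg Prod.snd heq
    linarith
  · -- `a = 0`: `L` is not surjective
    have hrange : ∀ q : E × ℝ, (L q).2 = 0 := by
      rintro ⟨v, t⟩
      have hq : ((v, t) : E × ℝ) = (v, 0) + t • ((0 : E), (1 : ℝ)) := by ext <;> simp
      rw [hq, map_add, map_smul, hLface]
      simp [heq]
    have h1 := hrange (L.symm (0, 1))
    rw [ContinuousLinearEquiv.apply_symm_apply] at h1
    exact one_ne_zero h1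

end NormalForm

/-! ### The stage -/

section Stage

variable {E : Type*} [NormedAddCommGroup E] [NormedSpace ℝ E] [FiniteDimensional ℝ E]
variable {H : Type*} [NormedAddCommGroup H] [NormedSpace ℝ H]
variable {H' : Type*} [NormedAddCommGroup H'] [NormedSpace ℝ H']
variable {Θ : OpenPartialHomeomorph (E × ℝ) H} {Θ' : OpenPartialHomeomorph (E × ℝ) H'}
  {u : H → H'} {Glow : E × ℝ → E × ℝ} {V : Set E} {δ : ℝ}

/-- **The codimension-one stage from a given package of crease estimates** (the core of
`exists_stage`): any neighbourhood `V' ⊇ K` with constants `a₀ > 0`, `A₀`, `C₀` for which the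
crease estimates of `CreaseSmoothing.lean` hold for `Glow` yields the stage with THESE constants.
[cite: CampbellDonofrioVitek2026, Lemma 3.1] -/
theorem IsCreaseNormalForm.exists_stage_of_estimates (h : IsCreaseNormalForm Θ Θ' u Glow V δ)
    (hΘ : ContDiffOn ℝ ∞ Θ Θ.source) (hΘs : ContDiffOn ℝ ∞ Θ.symm Θ.target)
    (hΘ' : ContDiffOn ℝ ∞ Θ' Θ'.source) (hΘ's : ContDiffOn ℝ ∞ Θ'.symm Θ'.target)
    {K : Set E} (hK : IsCompact K) (hKV : K ⊆ V) {V' : Set E} {a₀ A₀ C₀ : ℝ} (hV'o : IsOpen V')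
    (hKV' : K ⊆ V') (ha₀ : 0 < a₀)
    (hest : ∀ ε : ℝ, 0 < ε → ∃ L w : ℝ, 0 < L ∧ 0 < w ∧ 2 * w * Real.exp L ≤ ε ∧
      ∀ p : E × ℝ, p.1 ∈ V' → p.2 ∈ Icc 0 (2 * w * Real.exp L) →
        ‖creaseMap Glow L w p - p‖ ≤ ε ∧
        (∀ v : E, ‖fderiv ℝ (creaseMap Glow L w) p (v, 0) - (v, 0)‖ ≤ ε * ‖v‖) ∧
        a₀ ≤ (fderiv ℝ (creaseMap Glow L w) p (0, 1)).2 ∧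
        (fderiv ℝ (creaseMap Glow L w) p (0, 1)).2 ≤ A₀ ∧
        ‖(fderiv ℝ (creaseMap Glow L w) p (0, 1)).1‖ ≤ C₀) :
    ∃ V₀ : Set E, IsOpen V₀ ∧ K ⊆ V₀ ∧ V₀ ⊆ V ∧
      ∀ ε : ℝ, 0 < ε → ∃ (W : ℝ) (g : E × ℝ → E × ℝ), 0 < W ∧ W ≤ ε ∧ 2 * W < δ ∧
        ContDiff ℝ ∞ g ∧ (∀ p : E × ℝ, p.2 ≤ 0 → g p = Glow p) ∧ (∀ p : E × ℝ, W ≤ p.2 → g p = p) ∧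
        (∀ z, z ∉ creaseRegion Θ V₀ (δ / 2) →
          conjStage Θ Θ' g (creaseRegion Θ V₀ (δ / 2)) u z = u z) ∧
        (∀ z ∈ creaseRegion Θ V₀ (δ / 2), (Θ.symm z).2 ∉ Ioo 0 W →
          conjStage Θ Θ' g (creaseRegion Θ V₀ (δ / 2)) u z = u z) ∧
        (∀ z ∈ creaseRegion Θ V₀ (δ / 2),
          ContDiffAt ℝ ∞ (conjStage Θ Θ' g (creaseRegion Θ V₀ (δ / 2)) u) z ∧
          ∃ L : H ≃L[ℝ] H',
            HasFDerivAt (conjStage Θ Θ' g (creaseRegion Θ V₀ (δ / 2)) u) (L : H →L[ℝ] H') z) ∧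
        (∀ z ∈ creaseRegion Θ V₀ (δ / 2), (Θ.symm z).2 ∈ Icc 0 W →
          conjStage Θ Θ' g (creaseRegion Θ V₀ (δ / 2)) u z = Θ' (g (Θ.symm z)) ∧
          ‖g (Θ.symm z) - Θ.symm z‖ ≤ ε ∧
          (∀ v : E, ‖fderiv ℝ g (Θ.symm z) (v, 0) - (v, 0)‖ ≤ ε * ‖v‖) ∧
          a₀ ≤ (fderiv ℝ g (Θ.symm z) (0, 1)).2 ∧ (fderiv ℝ g (Θ.symm z) (0, 1)).2 ≤ A₀ ∧
          ‖(fderiv ℝ g (Θ.symm z) (0, 1)).1‖ ≤ C₀) := by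
  have hδ := h.pos
  -- the margin `η` keeping the band inside `Θ'.source`
  set C : Set (E × ℝ) := K ×ˢ Icc (0 : ℝ) (δ / 4) with hC_def
  have hCc : IsCompact C := hK.prod isCompact_Icc
  have hCsub : C ⊆ Θ'.source := by
    rintro ⟨k, t⟩ ⟨hk, ht⟩
    exact h.source' (k, t) (hKV hk) (by rw [abs_lt]; constructor <;> linarith [ht.1, ht.2])
  obtain ⟨η, hη, hηsub⟩ := hCc.exists_cthickening_subset_open Θ'.open_source hCsub
  -- the lateral region
  set V₀ : Set E := V' ∩ V ∩ thickening (η / 2) K with hV₀_def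
  have hV₀o : IsOpen V₀ := (hV'o.inter h.isOpen).inter isOpen_thickening
  have hKV₀ : K ⊆ V₀ := subset_inter (subset_inter hKV' hKV) (self_subset_thickening (by positivity) K)
  have hV₀V : V₀ ⊆ V := fun x hx => hx.1.2
  have hV₀V' : V₀ ⊆ V' := fun x hx => hx.1.1
  refine ⟨V₀, hV₀o, hKV₀, hV₀V, fun ε hε => ?_⟩
  -- the smallness actually fed to the crease lemma
  set ε' : ℝ := min ε (min (η / 2) (min (δ / 8) (a₀ / (2 * (a₀ + |C₀| + 1))))) with hε'_def
  have hε'pos : 0 < ε' := by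
    simp only [hε'_def, lt_min_iff]
    exact ⟨hε, by positivity, by positivity, by positivity⟩
  have hε'ε : ε' ≤ ε := min_le_left _ _
  have hε'η : ε' ≤ η / 2 := (min_le_right _ _).trans (min_le_left _ _)
  have hε'δ : ε' ≤ δ / 8 := (min_le_right _ _).trans ((min_le_right _ _).trans (min_le_left _ _))
  have hε'a : ε' ≤ a₀ / (2 * (a₀ + |C₀| + 1)) :=
    (min_le_right _ _).trans ((min_le_right _ _).trans (min_le_right _ _))
  have hε'small : ε' * (a₀ + C₀) < a₀ := by
    have h1 : ε' * (a₀ + C₀) ≤ ε' * (a₀ + |C₀| + 1) := by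
      apply mul_le_mul_of_nonneg_left _ hε'pos.le
      linarith [le_abs_self C₀]
    have h2 : ε' * (a₀ + |C₀| + 1) ≤ a₀ / 2 := by
      have hd : 0 < a₀ + |C₀| + 1 := by positivity
      calc ε' * (a₀ + |C₀| + 1) ≤ a₀ / (2 * (a₀ + |C₀| + 1)) * (a₀ + |C₀| + 1) :=
            mul_le_mul_of_nonneg_right hε'a hd.le
        _ = a₀ / 2 := by field_simp
    linarith
  obtain ⟨L, w, hL, hw, hWε', hh⟩ := hest ε' hε'pos
  set W : ℝ := 2 * w * exp L with hW_def
  have hW0 : 0 < W := by positivity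
  have hWδ : W ≤ δ / 8 := hWε'.trans hε'δ
  set g : E × ℝ → E × ℝ := creaseMap Glow L w with hg_def
  have hgs : ContDiff ℝ ∞ g := contDiff_creaseMap h.glow_contDiff hL hw
  have hg_low : ∀ p : E × ℝ, p.2 ≤ 0 → g p = Glow p := fun p hp => creaseMap_of_nonpos hw hp
  have hg_up : ∀ p : E × ℝ, W ≤ p.2 → g p = p := fun p hp => creaseMap_eq_self hL hw hp
  set S : Set H := creaseRegion Θ V₀ (δ / 2) with hS_def
  have hSo : IsOpen S := isOpen_creaseRegion Θ hV₀o _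
  have hST : S ⊆ Θ.target := creaseRegion_subset_target Θ V₀ _
  -- facts at a point of `S`
  have hpt : ∀ z ∈ S, Θ (Θ.symm z) = z ∧ (Θ.symm z).1 ∈ V₀ ∧ |(Θ.symm z).2| < δ / 2 := fun z hz =>
    ⟨Θ.right_inv hz.1, hz.2.1, hz.2.2⟩
  -- `g q ∈ Θ'.source` and `g` has an invertible derivative at `q`, for `q` in the half box
  have hgood : ∀ q : E × ℝ, q.1 ∈ V₀ → |q.2| < δ / 2 →
      g q ∈ Θ'.source ∧ ∃ Lq : (E × ℝ) ≃L[ℝ] E × ℝ, HasFDerivAt g (Lq : E × ℝ →L[ℝ] E × ℝ) q := by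
    intro q hq1 hq2
    have hqδ := abs_lt.1 hq2
    by_cases hband : q.2 ∈ Icc 0 W
    · -- the band: estimates
      obtain ⟨hd, hface, ha, hA, hc⟩ := hh q (hV₀V' hq1) hband
      refine ⟨?_, ?_⟩
      · -- within `η` of the compact `C`
        obtain ⟨k, hk, hdist⟩ := mem_thickening_iff.1 hq1.2
        have hkC : ((k, q.2) : E × ℝ) ∈ C := ⟨hk, hband.1, hband.2.trans (by linarith)⟩
        apply hηsub
        refine mem_cthickening_of_dist_le (g q) ((k, q.2) : E × ℝ) η C hkC ?_
        calc dist (g q) (k, q.2) ≤ dist (g q) q + dist q (k, q.2) := dist_triangle _ _ _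
          _ ≤ ε' + η / 2 := by
              gcongr
              · rw [dist_eq_norm]; exact hd
              · rw [Prod.dist_eq, dist_self, max_eq_left dist_nonneg]; exact hdist.le
          _ ≤ η := by linarith
      · obtain ⟨Lq, hLq⟩ := exists_equiv_of_face_normal_bounds (T := fderiv ℝ g q) ha₀ hface ha hc
          hε'small
        exact ⟨Lq, hLq ▸ ((hgs.differentiable (by simp)) q).hasFDerivAt⟩
    · rcases lt_or_gt_of_ne (fun heq : q.2 = 0 => hband ⟨heq.ge, heq ▸ hW0.le⟩) with hneg | hpos
      · -- below the face: `g = Glow` near `q`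
        have hev : g =ᶠ[𝓝 q] Glow := by
          have : ∀ᶠ p : E × ℝ in 𝓝 q, p.2 < 0 :=
            (continuous_snd.continuousAt).preimage_mem_nhds (Iio_mem_nhds hneg)
          filter_upwards [this] with p hp
          exact hg_low p hp.le
        obtain ⟨Lq, hLq⟩ := h.glow_deriv q (hV₀V hq1) (by linarith) hneg.le
        refine ⟨?_, Lq, hLq.congr_of_eventuallyEq hev⟩
        rw [hg_low q hneg.le]
        exact h.low_mem q (hV₀V hq1) (by linarith) hneg.le
      · -- above the band (`q.2 > W` since `q.2 ∉ [0, W]` and `q.2 > 0`): `g = id` near `q`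
        have hqW : W < q.2 := by
          by_contra hle
          exact hband ⟨hpos.le, not_lt.1 hle⟩
        have hev : g =ᶠ[𝓝 q] id := by
          have : ∀ᶠ p : E × ℝ in 𝓝 q, W < p.2 :=
            (continuous_snd.continuousAt).preimage_mem_nhds (Ioi_mem_nhds hqW)
          filter_upwards [this] with p hp
          exact hg_up p hp.le
        refine ⟨?_, ContinuousLinearEquiv.refl ℝ (E × ℝ), (hasFDerivAt_id q).congr_of_eventuallyEq hev⟩
        rw [hg_up q hqW.le]
        exact h.source' q (hV₀V hq1) (by rw [abs_lt]; constructor <;> linarith)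
  refine ⟨W, g, hW0, hWε'.trans hε'ε, by linarith, hgs, hg_low, hg_up,
    fun z hz => conjStage_of_not_mem hz, ?_, ?_, ?_⟩
  · -- outside the band the stage is the old map
    intro z hz hnot
    obtain ⟨hΘz, hq1, hq2⟩ := hpt z hz
    have hqδ := abs_lt.1 hq2
    rw [conjStage_of_mem hz]
    rcases le_or_gt (Θ.symm z).2 0 with hle | hpos
    · rw [hg_low _ hle, ← h.low _ (hV₀V hq1) (by linarith) hle, hΘz]
    · have hW' : W ≤ (Θ.symm z).2 := by
        by_contra hlt
        exact hnot ⟨hpos, not_le.1 hlt⟩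
      rw [hg_up _ hW', ← h.up _ (hV₀V hq1) hpos.le (by linarith), hΘz]
  · -- smoothness and invertible derivative on `S`
    intro z hz
    obtain ⟨-, hq1, hq2⟩ := hpt z hz
    obtain ⟨hmem, hLq⟩ := hgood (Θ.symm z) hq1 hq2
    exact ⟨contDiffAt_conjStage hSo hz hST hΘs hgs.contDiffAt hmem hΘ',
      exists_hasFDerivAt_equiv_conjStage hSo hz hST hΘ hΘs hΘ' hΘ's hmem hLq⟩
  · -- the record on the band
    intro z hz hband
    obtain ⟨-, hq1, -⟩ := hpt z hz
    obtain ⟨hd, hface, ha, hA, hc⟩ := hh (Θ.symm z) (hV₀V' hq1) hband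
    exact ⟨conjStage_of_mem hz, hd.trans hε'ε,
      fun v => (hface v).trans (mul_le_mul_of_nonneg_right hε'ε (norm_nonneg v)), ha, hA, hc⟩

/-- **The codimension-one stage** (see the module docstring).
[cite: CampbellDonofrioVitek2026, Lemma 3.1] -/
theorem IsCreaseNormalForm.exists_stage (h : IsCreaseNormalForm Θ Θ' u Glow V δ)
    (hΘ : ContDiffOn ℝ ∞ Θ Θ.source) (hΘs : ContDiffOn ℝ ∞ Θ.symm Θ.target)
    (hΘ' : ContDiffOn ℝ ∞ Θ' Θ'.source) (hΘ's : ContDiffOn ℝ ∞ Θ'.symm Θ'.target)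
    {K : Set E} (hK : IsCompact K) (hKV : K ⊆ V) :
    ∃ (a₀ A₀ C₀ : ℝ) (V₀ : Set E), 0 < a₀ ∧ IsOpen V₀ ∧ K ⊆ V₀ ∧ V₀ ⊆ V ∧
      ∀ ε : ℝ, 0 < ε → ∃ (W : ℝ) (g : E × ℝ → E × ℝ), 0 < W ∧ W ≤ ε ∧ 2 * W < δ ∧
        ContDiff ℝ ∞ g ∧ (∀ p : E × ℝ, p.2 ≤ 0 → g p = Glow p) ∧ (∀ p : E × ℝ, W ≤ p.2 → g p = p) ∧
        (∀ z, z ∉ creaseRegion Θ V₀ (δ / 2) →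
          conjStage Θ Θ' g (creaseRegion Θ V₀ (δ / 2)) u z = u z) ∧
        (∀ z ∈ creaseRegion Θ V₀ (δ / 2), (Θ.symm z).2 ∉ Ioo 0 W →
          conjStage Θ Θ' g (creaseRegion Θ V₀ (δ / 2)) u z = u z) ∧
        (∀ z ∈ creaseRegion Θ V₀ (δ / 2),
          ContDiffAt ℝ ∞ (conjStage Θ Θ' g (creaseRegion Θ V₀ (δ / 2)) u) z ∧
          ∃ L : H ≃L[ℝ] H',
            HasFDerivAt (conjStage Θ Θ' g (creaseRegion Θ V₀ (δ / 2)) u) (L : H →L[ℝ] H') z) ∧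
        (∀ z ∈ creaseRegion Θ V₀ (δ / 2), (Θ.symm z).2 ∈ Icc 0 W →
          conjStage Θ Θ' g (creaseRegion Θ V₀ (δ / 2)) u z = Θ' (g (Θ.symm z)) ∧
          ‖g (Θ.symm z) - Θ.symm z‖ ≤ ε ∧
          (∀ v : E, ‖fderiv ℝ g (Θ.symm z) (v, 0) - (v, 0)‖ ≤ ε * ‖v‖) ∧
          a₀ ≤ (fderiv ℝ g (Θ.symm z) (0, 1)).2 ∧ (fderiv ℝ g (Θ.symm z) (0, 1)).2 ≤ A₀ ∧
          ‖(fderiv ℝ g (Θ.symm z) (0, 1)).1‖ ≤ C₀) := by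
  obtain ⟨V', a₀, A₀, C₀, hV'o, hKV', ha₀, hest⟩ :=
    exists_creaseMap_estimates h.glow_contDiff hK h.isOpen hKV (fun x hx => h.face_fixed hx)
      fun x hx => h.creaseNormal_pos hx
  obtain ⟨V₀, hV₀o, hKV₀, hV₀V, hstage⟩ :=
    h.exists_stage_of_estimates hΘ hΘs hΘ' hΘ's hK hKV hV'o hKV' ha₀ hest
  exact ⟨a₀, A₀, C₀, V₀, ha₀, hV₀o, hKV₀, hV₀V, hstage⟩

/-- **The codimension-one stage with prescribed constants**: if margin-free bounds
`aS ≤ (creaseNormal Glow x).2`, `‖(creaseNormal Glow x).2‖ ≤ AS`, `‖(creaseNormal Glow x).1‖ ≤ CS`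
hold on the base `V` (`aS > 0`), the stage holds with `a₀ = min aS 1 / 2`, `A₀ = AS + 2`,
`C₀ = 2 CS + 1`. [cite: CampbellDonofrioVitek2026, Lemma 3.1] -/
theorem IsCreaseNormalForm.exists_stage_of_bounds (h : IsCreaseNormalForm Θ Θ' u Glow V δ)
    (hΘ : ContDiffOn ℝ ∞ Θ Θ.source) (hΘs : ContDiffOn ℝ ∞ Θ.symm Θ.target)
    (hΘ' : ContDiffOn ℝ ∞ Θ' Θ'.source) (hΘ's : ContDiffOn ℝ ∞ Θ'.symm Θ'.target)
    {K : Set E} (hK : IsCompact K) (hKV : K ⊆ V) {aS AS CS : ℝ} (haS : 0 < aS) (hAS : 0 ≤ AS)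
    (hCS : 0 ≤ CS) (haSb : ∀ x ∈ V, aS ≤ (creaseNormal Glow x).2)
    (hASb : ∀ x ∈ V, ‖(creaseNormal Glow x).2‖ ≤ AS) (hCSb : ∀ x ∈ V, ‖(creaseNormal Glow x).1‖ ≤ CS) :
    ∃ V₀ : Set E, IsOpen V₀ ∧ K ⊆ V₀ ∧ V₀ ⊆ V ∧
      ∀ ε : ℝ, 0 < ε → ∃ (W : ℝ) (g : E × ℝ → E × ℝ), 0 < W ∧ W ≤ ε ∧ 2 * W < δ ∧
        ContDiff ℝ ∞ g ∧ (∀ p : E × ℝ, p.2 ≤ 0 → g p = Glow p) ∧ (∀ p : E × ℝ, W ≤ p.2 → g p = p) ∧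
        (∀ z, z ∉ creaseRegion Θ V₀ (δ / 2) →
          conjStage Θ Θ' g (creaseRegion Θ V₀ (δ / 2)) u z = u z) ∧
        (∀ z ∈ creaseRegion Θ V₀ (δ / 2), (Θ.symm z).2 ∉ Ioo 0 W →
          conjStage Θ Θ' g (creaseRegion Θ V₀ (δ / 2)) u z = u z) ∧
        (∀ z ∈ creaseRegion Θ V₀ (δ / 2),
          ContDiffAt ℝ ∞ (conjStage Θ Θ' g (creaseRegion Θ V₀ (δ / 2)) u) z ∧
          ∃ L : H ≃L[ℝ] H',
            HasFDerivAt (conjStage Θ Θ' g (creaseRegion Θ V₀ (δ / 2)) u) (L : H →L[ℝ] H') z) ∧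
        (∀ z ∈ creaseRegion Θ V₀ (δ / 2), (Θ.symm z).2 ∈ Icc 0 W →
          conjStage Θ Θ' g (creaseRegion Θ V₀ (δ / 2)) u z = Θ' (g (Θ.symm z)) ∧
          ‖g (Θ.symm z) - Θ.symm z‖ ≤ ε ∧
          (∀ v : E, ‖fderiv ℝ g (Θ.symm z) (v, 0) - (v, 0)‖ ≤ ε * ‖v‖) ∧
          min aS 1 / 2 ≤ (fderiv ℝ g (Θ.symm z) (0, 1)).2 ∧ (fderiv ℝ g (Θ.symm z) (0, 1)).2 ≤ AS + 2 ∧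
          ‖(fderiv ℝ g (Θ.symm z) (0, 1)).1‖ ≤ 2 * CS + 1) := by
  obtain ⟨V', hV'o, hKV', hest⟩ :=
    exists_creaseMap_estimates_of_bounds h.glow_contDiff hK h.isOpen hKV
      (fun x hx => h.face_fixed hx) haS hAS hCS haSb hASb hCSb
  exact h.exists_stage_of_estimates hΘ hΘs hΘ' hΘ's hK hKV hV'o hKV' (by positivity) hest


end Stage


end Literature.Topology.FourManifolds
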